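import Mathlib
import HarnessLib
import Summits.QuantumFields.YangMills.Theses.ScalingWindowSplit
import Summits.QuantumFields.YangMills.Theorems.SelfNormalisedSkewness.Negative.TreeLevelSkewnessVanishes

/-!
# `SelfNormalisedSkewness` (stmt-QuantumFields-18944) — negative lemma modulo `H`:
# a Maxwell-dominated window scheme refutes W₂ as typed

Crux W₂ = `ScalingWindowSplit.SelfNormalisedSkewness` (route `ScalingWindowSplit`): for EVERY compact
`G`, faithful `r`, weak-coupling scheme with polynomial volumes and past-supported bump `u` meeting the
floor `a_k^p ≤ T⁰_k(u,θu)` and the window `T⁰_k(u,θu) ≤ M·T⁰_k(τ₋₁u,θτ₋₁u)`, SOME pairwise disjoint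
Schwartz triple `f, g, h` has its self-normalised third cumulant `κ₃^canon_k(f,g,h)` eventually
`≥ δ > 0` in size.  The planner's only support: "true for Wick squares of a free field, hence in the
Coulomb phase and in the deep UV".

**The tree-level value is zero.**  The landed certificate `treeLevelSkewness_vanishes` (birth-vetting
refuter, p143515) shows that `tr K(h₁)K(h₂)K(h₃) = 0` for traceless symmetric `hᵢ`.  This file makes
it CONCRETE for the free Euclidean Maxwell field of `d = 4`: `hessInvSq x` is the Hessian of the
harmonic propagator `|x|⁻²` (symmetric, `hessInvSq_isSymm`; traceless for every `x`,
`hessInvSq_trace` — harmonicity of `|x|^{2-d}` in `d = 4`), `maxwellKernel x = K (hessInvSq x)` is the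
field-strength covariance `⟨F_{μν}(x)F_{ρσ}(0)⟩` in the plane basis (up to the positive factor
`4π²`), the odd ring `tr G(x−y)G(y−z)G(z−x)` vanishes at ALL points (`maxwellOddRing_eq_zero`), hence
the Gaussian third-cumulant functional `maxwellRing3 f g h` of the Wick square `F_{μν}F_{μν}` is `0`
for all Schwartz `f, g, h` (`maxwellRing3_eq_zero`) and so is the Gaussian prediction
`maxwellSkewRatio u f g h = 8·R₃(f,g,h)/(2·R₂(u))^{3/2}` for the crux's scale-free skewness
(`maxwellSkewRatio_eq_zero`); the even ring is NOT degenerate (`maxwellEvenRing_e₀_ne_zero`: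
`tr G(e₀)G(−e₀) = 96`).

**`H` and the negative lemma.**  `MaxwellDominatedWindowScheme` (`H`): some admissible datum
`(G, r, sch, u, p, M)` of W₂ — meeting EXACTLY its four hypotheses — along which, for every pairwise
disjoint Schwartz triple, `κ₃^canon_k(f,g,h)` converges to its free-Maxwell value
`maxwellSkewRatio u f g h`.  `SelfNormalisedSkewness_false_of_MaxwellDominatedWindowScheme : H → ¬ W₂`
(the crux at the datum gives a `δ`-floor; `H` and `maxwellSkewRatio_eq_zero` give `κ₃^canon → 0`).

**Why `H` is expected, and why it is not constructible here.**  Two families of intended inhabitants,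
both GENUINE sub-cases of the crux as typed (the crux is group-blind and its window bounds `a_kξ_k`
only from below): (i) `G = U(1)` (`Circle`, `ρ(z) = (z)`), `a_k = 1/(k+1)`, `L_k = (k+1)²`, `β_k → ∞`
polynomially: in the Coulomb phase the plaquette angle is `β^{-1/2}`× (lattice Maxwell field) up to
`O(β⁻¹)` anharmonic and `O(e^{−cβ})` monopole corrections (Guth 1980; Fröhlich–Spencer 1982; Driver
1987, convergence of `U(1)₄` to free photons), so `T⁰_k(u) ≍ a_k⁸β_k⁻²·2R₂(u)` (floor with `p = 9+`,
window with `M = 2R₂(u)/R₂(τ₋₁u)`), while `κ₃^bare_k ≍ a_k¹²β_k⁻³·[8R₃ = 0] + O(a_k¹²β_k⁻⁴) + O(a_k¹³β_k⁻³)`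
(the LATTICE odd ring is an `O(a)` artefact: kit jobs j023616/j023622 of the r1 ideators,
`Cruxes/SelfNormalisedSkewness/MaxwellOddRing-r1-i2.md`), i.e. `κ₃^canon_k → 0 = maxwellSkewRatio`;
(ii) any compact `G` (simple included) along DEEP-UV window schemes `a_kξ_k → ∞` with `β_k` polynomial
in `k`: asymptotic freedom at every fixed physical scale, free gluons = `dim G` diagonal copies of (i),
`κ₃^canon = O(g²(physical scale)) → 0`.  Inhabiting `H` in the tree needs two-sided weak-coupling
asymptotics of COMPOSITE-operator cumulants of `U(1)₄` (resp. of asymptotically free YM₄ in the deep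
UV) with error control at physical separation — Bałaban/Driver-level constructive work, not available
as tree theorems.  Hence a NEGATIVE LEMMA MODULO `H`, not a refutation: the item stays open (held).

**Class on paper: refuted-misstated; repair.**  The `∀` over groups/schemes includes regimes the route's
mechanism (existence leg at ONE scale) never uses and where the tree-level value `0` is the truth.
Minimal repair `C′` (birth refuter's `SelfNormalisedSkewnessGapped`, evidence Repaired.lean on the
item): binder `(M Δ : ℝ)` and `0 < Δ → HasLatticeMassGap r sch Δ →` right after
`sch.HasWeakCouplingLimit →`; the volume-uniform physical gap fails in the Coulomb phase and along
deep-UV schemes (physical mass `1/(a_kξ_k) → 0`), so both inhabitant families of `H` miss `C′`, and the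
glue `existenceLeg` needs only W₁'s `Δ` as one more argument.  (This disprover's companion file
`SelfNormalisedSkewnessFalseWithoutFloor` shows the FLOOR is load-bearing too: without it the trivial
group is an unconditional counterexample.)

Contents: `nsq`, `hessInvSq` (+ `_isSymm`, `_trace`), `maxwellKernel`, `maxwellOddRing_eq_zero`, `e₀`,
`maxwellEvenRing_e₀_ne_zero`, `maxwellRing2`, `maxwellRing3` (+ `_eq_zero`), `maxwellSkewRatio`
(+ `_eq_zero`), crux vocabulary `cruxBare`, `cruxT`, `cruxCanon`, `cruxKappa3` (the crux's `let`s, after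
the r1 ideator's Sketch), `MaxwellDominatedWindowScheme` (`H`),
`SelfNormalisedSkewness_false_of_MaxwellDominatedWindowScheme` (`H → ¬ W₂`).
No `sorry`; axioms `propext`, `Classical.choice`, `Quot.sound`.  Refuter (cdisprove) artefact, 2026-08-17.
-/

noncomputable section

open scoped SchwartzMap BigOperators Topology
open MeasureTheory Filter Topology Matrix
open Literature.MathematicalPhysics.AQFT Literature.MathematicalPhysics.QuantumLattice
open Literature.MathematicalPhysics.QuantumFieldTheory

namespace Summit.QuantumFields.YangMills.Theorems.SelfNormalisedSkewness.Negative

/-- Euclidean `ℝ⁴`. [folklore] -/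
abbrev E4 : Type := EuclideanSpace ℝ (Fin 4)

/-! ## The free Maxwell field-strength covariance of `d = 4` and its rings -/

/-- `|x|²` as the polynomial `∑ᵢ xᵢ²`. [folklore] -/
def nsq (x : E4) : ℝ := ∑ i, x i ^ 2

/-- The Hessian of the harmonic propagator `D(x) = |x|⁻²` of `d = 4` (the free massless two-point
function up to the factor `1/(4π²)`): `∂_μ∂_ρ|x|⁻² = (8x_μx_ρ − 2δ_{μρ}|x|²)/|x|⁶`; junk value `0` at
`x = 0`. [folklore] -/
def hessInvSq (x : E4) : Matrix (Fin 4) (Fin 4) ℝ := fun μ ρ =>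
  8 * x μ * x ρ / nsq x ^ 3 - 2 * δ μ ρ / nsq x ^ 2

/-- The Hessian is symmetric. [folklore] -/
theorem hessInvSq_isSymm (x : E4) : (hessInvSq x).IsSymm :=
  Matrix.IsSymm.ext fun i j => by
    unfold hessInvSq δ
    by_cases hij : i = j
    · subst hij; rfl
    · rw [if_neg hij, if_neg (Ne.symm hij)]; ring

/-- The Hessian is traceless: `Δ|x|⁻² = 0` away from the origin (`|x|^{2-d}` is harmonic, `d = 4`),
and `0` by the junk convention at the origin. [folklore] -/
theorem hessInvSq_trace (x : E4) : (hessInvSq x).trace = 0 := by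
  have hsum : ∑ μ : Fin 4, 8 * x μ * x μ / nsq x ^ 3 = 8 * nsq x / nsq x ^ 3 := by
    rw [← Finset.sum_div, nsq, Finset.mul_sum]
    congr 1
    exact Finset.sum_congr rfl fun μ _ => by ring
  simp only [Matrix.trace, Matrix.diag, hessInvSq, δ, if_true, Finset.sum_sub_distrib, hsum,
    Finset.sum_const, Finset.card_univ, Fintype.card_fin, nsmul_eq_mul]
  by_cases h0 : nsq x = 0
  · simp [h0]
  · field_simp
    ring

/-- **The free Maxwell field-strength covariance** `G(x) = ⟨F_{μν}(x)F_{ρσ}(0)⟩` of Euclidean `d = 4`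
in the plane basis `01,02,03,12,13,23` (for `⟨A_νA_σ⟩ = δ_{νσ}|x|⁻²`, i.e. up to the positive factor
`4π²`): `K` of the Hessian of the propagator. [folklore] -/
def maxwellKernel (x : E4) : Matrix (Fin 6) (Fin 6) ℝ := K (hessInvSq x)

/-- **The free-Maxwell odd ring vanishes at ALL points**: `tr G(x−y)G(y−z)G(z−x) = 0` — the landed
`treeLevelSkewness_vanishes` at the concrete Hessians (each `G` swaps self-dual and anti-self-dual
2-forms).  It is `⅛` of the Gaussian third cumulant density of the Wick square `F_{μν}F_{μν}` at
`x, y, z`. [folklore] -/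
theorem maxwellOddRing_eq_zero (x y z : E4) :
    (maxwellKernel (x - y) * maxwellKernel (y - z) * maxwellKernel (z - x)).trace = 0 :=
  treeLevelSkewness_vanishes _ _ _ (hessInvSq_isSymm _) (hessInvSq_isSymm _) (hessInvSq_isSymm _)
    (hessInvSq_trace _) (hessInvSq_trace _) (hessInvSq_trace _)

/-- The unit time vector `e₀`. [folklore] -/
def e₀ : E4 := EuclideanSpace.single 0 1

/-- **Non-degeneracy of the even ring**: `tr G(e₀)G(−e₀) = 96 ≠ 0` — the Gaussian covariance density
of the Wick square `F²` at the reflected pair `±e₀` does not vanish, so the two-ring functional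
`maxwellRing2` below is not trivially zero (only the ODD rings die). [folklore] -/
theorem maxwellEvenRing_e₀_ne_zero :
    (maxwellKernel (e₀ - -e₀) * maxwellKernel (-e₀ - e₀)).trace ≠ 0 := by
  have h1 : e₀ - -e₀ = (2 : ℝ) • e₀ := by rw [sub_neg_eq_add, two_smul]
  have h2 : -e₀ - e₀ = (-2 : ℝ) • e₀ := by rw [neg_smul, two_smul, neg_add, sub_eq_add_neg]
  -- `hessInvSq` is homogeneous of degree `-4`: at `±2e₀` it is `diag(6,-2,-2,-2)/16`
  have hh : ∀ s : ℝ, (s = 2 ∨ s = -2) → hessInvSq (s • e₀) = (16 : ℝ)⁻¹ • Matrix.diagonal ![6, -2, -2, -2] := by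
    intro s hs
    have hs2 : s ^ 2 = 4 := by rcases hs with rfl | rfl <;> norm_num
    have hn : nsq (s • e₀) = 4 := by
      simp [nsq, e₀, hs2]
    ext μ ρ
    simp only [hessInvSq, hn, δ, Matrix.smul_apply, smul_eq_mul]
    fin_cases μ <;> fin_cases ρ <;> simp [e₀, Matrix.diagonal] <;> nlinarith [hs2]
  rw [h1, h2, maxwellKernel, maxwellKernel, hh 2 (Or.inl rfl), hh (-2) (Or.inr rfl)]
  simp [Matrix.trace, Matrix.mul_apply, Fin.sum_univ_succ, K, p1, p2, δ, Matrix.diagonal]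
  norm_num

/-- **The continuum free-Maxwell two-ring functional** at the reflected pair `(w, θw)`:
`R₂(w) = ∫∫ w(x) (θw)(y) tr G(x−y)G(y−x)` — one half of the Gaussian (Wick) covariance of the smeared
Wick squares `F²(w)`, `F²(θw)`, in the normalisation of `maxwellKernel`. [folklore] -/
def maxwellRing2 (w : 𝓢(E4, ℝ)) : ℝ :=
  ∫ x, ∫ y, w x * thetaTest 4 w y * (maxwellKernel (x - y) * maxwellKernel (y - x)).trace

/-- **The continuum free-Maxwell three-ring functional** `R₃(f,g,h) = ∫∫∫ f(x)g(y)h(z) tr G(x−y)G(y−z)G(z−x)`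
— one eighth of the Gaussian (Wick) third cumulant of `F²(f), F²(g), F²(h)`. [folklore] -/
def maxwellRing3 (f g h : 𝓢(E4, ℝ)) : ℝ :=
  ∫ x, ∫ y, ∫ z, f x * g y * h z *
    (maxwellKernel (x - y) * maxwellKernel (y - z) * maxwellKernel (z - x)).trace

/-- The three-ring functional vanishes identically (all `f, g, h`; no support condition is even
needed, the density being pointwise `0`). [folklore] -/
theorem maxwellRing3_eq_zero (f g h : 𝓢(E4, ℝ)) : maxwellRing3 f g h = 0 := by
  simp [maxwellRing3, maxwellOddRing_eq_zero]

/-- **The Gaussian (free-Maxwell, tree-level) prediction for the crux's self-normalised skewness**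
`κ₃^canon(f,g,h) = κ₃/T(u,θu)^{3/2}` by Wick's rule for the Wick square `F²`: `κ₃ = 8R₃`, `T = 2R₂`,
ratio `8R₃(f,g,h)/(2R₂(u))^{3/2}` (scale-free: the normalisation of `G` drops out up to sign). [folklore] -/
def maxwellSkewRatio (u f g h : 𝓢(E4, ℝ)) : ℝ :=
  8 * maxwellRing3 f g h / Real.sqrt ((2 * maxwellRing2 u) ^ 3)

/-- **The tree-level prediction is `0`** for every reference pair `u` and every triple `f, g, h`. [folklore] -/
theorem maxwellSkewRatio_eq_zero (u f g h : 𝓢(E4, ℝ)) : maxwellSkewRatio u f g h = 0 := by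
  simp [maxwellSkewRatio, maxwellRing3_eq_zero]

/-! ## The crux's vocabulary (its `let`s, named; after the r1 ideator's Sketch) -/

section Crux

variable {G : Type} [Group G] [TopologicalSpace G] [IsTopologicalGroup G] [CompactSpace G]
  [MeasurableSpace G] [BorelSpace G]

/-- The crux's BARE scheme `bare` (`c ≡ 1`, `m ≡ 0`). [folklore] -/
def cruxBare (sch : SpeciesScheme (YMSpecies G)) : SpeciesScheme (YMSpecies G) :=
  { sch with c := fun _ _ => 1, m := fun _ _ => 0 }

/-- The crux's `T w k`: bare truncated plaquette two-point function at the reflected pair `(w, θw)`.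
[folklore] -/
def cruxT (r : LatticeRep G) (sch : SpeciesScheme (YMSpecies G)) (w : 𝓢(E4, ℝ)) (k : ℕ) : ℝ :=
  latticeSchwinger r.ρ (cruxBare sch) (fun s => s.F) k (1 + 1) (fun _ => r.curvature) ![w, thetaTest 4 w] -
    latticeSchwinger r.ρ (cruxBare sch) (fun s => s.F) k 1 (fun _ => r.curvature) ![w] *
      latticeSchwinger r.ρ (cruxBare sch) (fun s => s.F) k 1 (fun _ => r.curvature) ![thetaTest 4 w]

/-- The crux's SELF-NORMALISED scheme `canon` (`c'_k = 1/√T_k(u)`, `m'_k = ⟨F⟩_k`). [folklore] -/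
def cruxCanon (r : LatticeRep G) (sch : SpeciesScheme (YMSpecies G)) (u : 𝓢(E4, ℝ)) :
    SpeciesScheme (YMSpecies G) :=
  { sch with
    c := fun _ k => (Real.sqrt (cruxT r sch u k))⁻¹
    m := fun _ k => ∫ U, r.curvature.F (torusLift (sch.side k) U) ∂(wilsonMeasure r.ρ (sch.β k)) }

/-- The crux's self-normalised third cumulant `κ₃^canon_k(f, g, h)` (written in moments, verbatim the
IRInputs-(d) expression). [folklore] -/
def cruxKappa3 (r : LatticeRep G) (sch : SpeciesScheme (YMSpecies G)) (u f g h : 𝓢(E4, ℝ))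
    (k : ℕ) : ℝ :=
  latticeSchwinger r.ρ (cruxCanon r sch u) (fun s => s.F) k 3 (fun _ => r.curvature) ![f, g, h] -
    latticeSchwinger r.ρ (cruxCanon r sch u) (fun s => s.F) k 1 (fun _ => r.curvature) ![f] *
      latticeSchwinger r.ρ (cruxCanon r sch u) (fun s => s.F) k 2 (fun _ => r.curvature) ![g, h] -
    latticeSchwinger r.ρ (cruxCanon r sch u) (fun s => s.F) k 1 (fun _ => r.curvature) ![g] *
      latticeSchwinger r.ρ (cruxCanon r sch u) (fun s => s.F) k 2 (fun _ => r.curvature) ![f, h] -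
    latticeSchwinger r.ρ (cruxCanon r sch u) (fun s => s.F) k 1 (fun _ => r.curvature) ![h] *
      latticeSchwinger r.ρ (cruxCanon r sch u) (fun s => s.F) k 2 (fun _ => r.curvature) ![f, g] +
    2 * (latticeSchwinger r.ρ (cruxCanon r sch u) (fun s => s.F) k 1 (fun _ => r.curvature) ![f] *
      latticeSchwinger r.ρ (cruxCanon r sch u) (fun s => s.F) k 1 (fun _ => r.curvature) ![g] *
        latticeSchwinger r.ρ (cruxCanon r sch u) (fun s => s.F) k 1 (fun _ => r.curvature) ![h])

end Crux

/-! ## `H` and the negative lemma -/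

/-- **`H` — a MAXWELL-DOMINATED WINDOW SCHEME** (the hypothesis of this negative lemma; NOT
constructible in the tree; deliberately untagged: it is a hypothesis of this file, not a literature
fact).  Some compact gauge group `G` with a faithful unitary lattice representation `r`, a scheme
`sch`, a bump `u`, an exponent `p` and a window constant `M` meet EXACTLY the four hypotheses of W₂
(weak coupling `β_k → ∞`, polynomial volumes, `tsupport u ⊆ {y⁰ < 0}`, eventually floor ∧ window at
`u`), and along this datum the self-normalised skewness of the curvature field `tr F²` is
asymptotically GAUSSIAN-DOMINATED: for every pairwise disjoint Schwartz triple `f, g, h`,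
`κ₃^canon_k(f,g,h) → maxwellSkewRatio u f g h`, its free-Maxwell (Wick-square, tree-level) value.
Intended inhabitants (module docstring): `G = U(1)` in the Coulomb phase along any polynomially
weak-coupling scheme (Guth 1980, Fröhlich–Spencer 1982, Driver 1987), and every compact `G` along
deep-UV window schemes `a_kξ_k → ∞` (asymptotic freedom). -/
def MaxwellDominatedWindowScheme : Prop :=
  ∃ (G : Type) (_ : Group G) (_ : TopologicalSpace G) (_ : IsTopologicalGroup G) (_ : CompactSpace G)
    (_ : MeasurableSpace G) (_ : BorelSpace G) (r : LatticeRep G) (sch : SpeciesScheme (YMSpecies G))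
    (u : 𝓢(E4, ℝ)) (p : ℕ) (M : ℝ),
    sch.HasWeakCouplingLimit ∧
    (∃ N : ℕ, 1 ≤ N ∧ ∀ᶠ k in Filter.atTop, (sch.a k)⁻¹ ≤ (sch.a k * (sch.L k : ℝ)) ^ N) ∧
    tsupport u ⊆ {y : E4 | y 0 < 0} ∧
    (∀ᶠ k in Filter.atTop, (sch.a k) ^ p ≤ cruxT r sch u k ∧
      cruxT r sch u k ≤ M * cruxT r sch (timeShiftTest 4 (-1) u) k) ∧
    ∀ f g h : 𝓢(E4, ℝ), Disjoint (tsupport f) (tsupport g) → Disjoint (tsupport f) (tsupport h) →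
      Disjoint (tsupport g) (tsupport h) →
        Tendsto (cruxKappa3 r sch u f g h) atTop (𝓝 (maxwellSkewRatio u f g h))

/-- **Negative lemma modulo `H`: a Maxwell-dominated window scheme refutes W₂ as typed.**
`MaxwellDominatedWindowScheme → ¬ SelfNormalisedSkewness`: instantiate the crux at the datum of `H`;
its `δ`-floor `δ ≤ |κ₃^canon_k(f,g,h)|` (eventually) contradicts `κ₃^canon_k(f,g,h) → maxwellSkewRatio
u f g h = 0` (`maxwellSkewRatio_eq_zero`, i.e. `maxwellOddRing_eq_zero`, i.e. the landed
`treeLevelSkewness_vanishes`).  Class on paper: refuted-misstated; the repaired statement `C′` adds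
`0 < Δ → HasLatticeMassGap r sch Δ →` (W₁'s gap), which no intended inhabitant of `H` meets. [folklore] -/
theorem SelfNormalisedSkewness_false_of_MaxwellDominatedWindowScheme :
    MaxwellDominatedWindowScheme →
      ¬ Summit.QuantumFields.YangMills.Theses.ScalingWindowSplit.SelfNormalisedSkewness := by
  rintro ⟨G, _, _, _, _, _, _, r, sch, u, p, M, hw, hpv, hu, hfw, hlim⟩ hS
  obtain ⟨f, g, h₃, δ, hfg, hfh, hgh, hδ, hev⟩ := hS G r sch u p M hw hpv hu hfw
  have hev' : ∀ᶠ k in atTop, δ ≤ |cruxKappa3 r sch u f g h₃ k| := hev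
  have ht : Tendsto (cruxKappa3 r sch u f g h₃) atTop (𝓝 0) := by
    simpa only [maxwellSkewRatio_eq_zero] using hlim f g h₃ hfg hfh hgh
  have hsmall : ∀ᶠ k in atTop, |cruxKappa3 r sch u f g h₃ k| < δ := by
    refine ((Metric.tendsto_nhds.1 ht) δ hδ).mono fun k hk => ?_
    simpa [Real.dist_eq] using hk
  obtain ⟨k, hk₁, hk₂⟩ := (hev'.and hsmall).exists
  exact absurd hk₁ (not_le.2 hk₂)

end Summit.QuantumFields.YangMills.Theorems.SelfNormalisedSkewness.Negative

end
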